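import Literature.Probability.RandomPlanarGeometry.SLEDerivRatioMartingaleProofs
import Literature.Probability.RandomPlanarGeometry.SLETransienceEntailsTrace
import Literature.Probability.RandomPlanarGeometry.SLETransienceAssembly
import HarnessLib

/-!
# The space-filling phase `κ ≥ 8` (Rohde–Schramm (2005), Cor. 7.4) from transience alone

Topic `Probability/RandomPlanarGeometry`; theorems only, nothing is redefined and no named fact is
introduced. Bookkeeping on the named fact
`Literature.Probability.RandomPlanarGeometry.ae_isSpaceFilling_sleTrace_of_eight_le`
(`CritPercSLE.lean`; S. Rohde, O. Schramm, *Basic properties of SLE*, Ann. of Math. 161 (2005),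
Cor. 7.4 "Suppose that `κ > 8`, then `γ[0, ∞) = ℍ̄` a.s." with the Update (p. 924 / arXiv p. 18)
"Corollary 7.4 and Theorem 7.1 are true also for `κ = 8`").

The printed proof (p. 911) has two inputs: "From Lemma 6.3 and (6.2) we know that `γ[0, ∞)` is
a.s. dense in `ℍ̄`" — **proved** in this library (`ae_subset_closure_range_sleTrace_of_hasSLETrace`,
resting on the Itô step `sle_martingale_rsObservable_holds` and
`tendsto_sleDerivRatio_atTop_of_eight_le_holds` of `SLEDerivRatioMartingaleProofs`) — and "Since `γ`
is a.s. transient, `γ[0, ∞)` is closed in `ℂ`" (Thm. 7.1). The per-`κ` assembly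
`ae_isSpaceFilling_sleTrace_of_hasSLETrace_of_eight_le` therefore asked for `HasSLETrace κ`
(Thm. 5.1 at `κ`, resp. Lawler–Schramm–Werner (2004), Thm. 4.7 at `κ = 8`) and a.s. transience at
`κ`. Since in this library's encoding a.s. transience of `sleTrace κ` already forces the chain to
be generated by a curve (`hasSLETrace_of_ae_tendsto_norm_sleTrace_atTop`, `SLETransienceEntailsTrace`:
the junk trace is a constant path), the hypothesis `HasSLETrace κ` is redundant:

* `ae_isSpaceFilling_sleTrace_of_ae_tendsto_norm_atTop` (**proved**): for one `κ ≥ 8`, a.s.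
  transience of `sleTrace κ` alone implies that `sleTrace κ` is a.s. space-filling;
* `ae_isSpaceFilling_sleTrace_of_eight_le_of_tendsto_norm_sleTrace_atTop` (**proved**): the named
  fact follows from the single named fact `tendsto_norm_sleTrace_atTop` (Thm. 7.1 with the Update),
  equivalently (`ae_isSpaceFilling_sleTrace_of_eight_le_of_exists_isSLECurve`) from
  `exists_isSLECurve`;
* `ae_isSpaceFilling_sleTrace_of_eight_le_of_leaf_facts` (**proved**): the named fact from the
  finest inputs the tree currently isolates for `κ ≥ 8` — Rohde–Schramm's derivative estimate
  Cor. 3.5 on the canonical space (`RohdeSchramm2005_cor35`, through which Thm. 5.1 gives the trace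
  for `κ > 8`), the conclusion of Lemma 7.3 at time `1` for `κ > 8` (the `κ > 8` branch of
  `RohdeSchramm2005_lem73`), SLE₈ generated by a curve (`hasSLETrace_eight`, [LSW] Thm. 4.7) and the
  Update of Thm. 7.1 at `κ = 8` (`RohdeSchramm2005_thm71_eight`); Lemma 7.2 and the simple-path
  step of p. 911 (the `κ ≤ 4` inputs of Thm. 7.1) are not needed;
* `hasSLETrace_of_ae_isSpaceFilling_sleTrace` (**proved**): conversely the conclusion forces
  `HasSLETrace κ` (the junk trace has range `{0} ≠ ℍ̄`), so that the fact carries Thm. 5.1 /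
  [LSW] Thm. 4.7 at `κ` with it, exactly as the transience fact does.

## References

* S. Rohde, O. Schramm, *Basic properties of SLE*, Ann. of Math. 161 (2005) 883–924: Cor. 7.4 and
  its proof, Thm. 7.1, Update (p. 911 / p. 924); Lemma 6.3, eq. (6.2); Lemma 7.3; Cor. 3.5, Thm. 5.1.
* G. F. Lawler, O. Schramm, W. Werner, *Conformal invariance of planar loop-erased random walks
  and uniform spanning trees*, Ann. Probab. 32 (2004) 939–995, Thm. 4.7.
-/

noncomputable section

open Set Filter Topology MeasureTheory
open UpperHalfPlane (upperHalfPlaneSet)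
open scoped NNReal

namespace Literature.Probability.RandomPlanarGeometry

open Loewner

variable {κ : ℝ≥0}

/-! ### One `κ ≥ 8` at a time -/

/-- **Cor. 7.4 at one `κ ≥ 8` from transience at that `κ` alone.** If the SLE_κ trace is a.s.
transient (`|γ(t)| → ∞`), then for `κ ≥ 8` it is a.s. space-filling (`γ[0, ∞) = ℍ̄`): a.s.
transience forces the chain to be generated by a curve
(`hasSLETrace_of_ae_tendsto_norm_sleTrace_atTop`), the range is then a.s. dense by Lemma 6.3 and
eq. (6.2) (`ae_subset_closure_range_sleTrace_of_hasSLETrace`, proved) and closed by transience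
(`ae_isSpaceFilling_sleTrace_of_hasSLETrace`). [cite: RohdeSchramm2005, Cor. 7.4 and Update (p. 911)] -/
theorem ae_isSpaceFilling_sleTrace_of_ae_tendsto_norm_atTop (hκ : 8 ≤ κ)
    (htr : ∀ᵐ ω ∂Process.preWienerMeasure, Tendsto (fun t ↦ ‖sleTrace κ ω t‖) atTop atTop) :
    ∀ᵐ ω ∂Process.preWienerMeasure, IsSpaceFilling (sleTrace κ ω) :=
  ae_isSpaceFilling_sleTrace_of_hasSLETrace_of_eight_le
    (hasSLETrace_of_ae_tendsto_norm_sleTrace_atTop htr) htr hκ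

/-- **A.s. space-filling forces the chain to be generated by a curve.** If the Loewner chain of
`√κ B(ω)` is not generated by a curve, `sleTrace κ ω` is the constant junk path `0`, whose range
`{0}` is not `ℍ̄` (`i ∈ ℍ̄`); so on the full-measure set where `γ[0, ∞) = ℍ̄` a generating curve
exists. In Rohde–Schramm (2005) the curve of Cor. 7.4 is the path given by Thm. 5.1 (by [LSW] at
`κ = 8`); this records that the library's encoding of Cor. 7.4 carries that existence statement
with it. [cite: RohdeSchramm2005, Cor. 7.4 and Thm 5.1] -/
theorem hasSLETrace_of_ae_isSpaceFilling_sleTrace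
    (h : ∀ᵐ ω ∂Process.preWienerMeasure, IsSpaceFilling (sleTrace κ ω)) : HasSLETrace κ := by
  filter_upwards [h] with ω hω
  by_contra hne
  have hconst : sleTrace κ ω = fun _ ↦ ((sleDriving κ ω 0 : ℝ) : ℂ) := by
    unfold sleTrace Loewner.trace
    rw [dif_neg hne]
  have hI : Complex.I ∈ range (sleTrace κ ω) := by
    rw [hω]
    exact subset_closure (show (0 : ℝ) < Complex.I.im by simp)
  rw [hconst, sleDriving_zero] at hI
  obtain ⟨_, ht⟩ := hI
  have := congrArg Complex.im ht
  simp at this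

/-- The named fact at `κ`, granted, yields `HasSLETrace κ` for that `κ ≥ 8`.
[cite: RohdeSchramm2005, Cor. 7.4 and Thm 5.1] -/
theorem hasSLETrace_of_ae_isSpaceFilling_sleTrace_of_eight_le
    (h : ae_isSpaceFilling_sleTrace_of_eight_le (κ := κ)) (hκ : 8 ≤ κ) : HasSLETrace κ :=
  hasSLETrace_of_ae_isSpaceFilling_sleTrace (h hκ)

/-! ### The named fact from the transience fact alone -/

/-- **`ae_isSpaceFilling_sleTrace_of_eight_le` from `tendsto_norm_sleTrace_atTop` alone**
(Rohde–Schramm (2005), Cor. 7.4 with the Update, from Thm. 7.1 with the Update): of the three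
trace theorems fed to `ae_isSpaceFilling_sleTrace_of_eight_le_of_traceFacts`, the transience fact
entails the other two in this encoding (`hasSLETrace_eight_of_tendsto_norm_sleTrace_atTop`,
`hasSLETrace_of_ne_eight_of_tendsto_norm_sleTrace_atTop`), and only its instance at the given
`κ ≥ 8` is used. [cite: RohdeSchramm2005, Cor. 7.4 and Update (p. 911)] -/
theorem ae_isSpaceFilling_sleTrace_of_eight_le_of_tendsto_norm_sleTrace_atTop
    (htr : tendsto_norm_sleTrace_atTop) : ae_isSpaceFilling_sleTrace_of_eight_le (κ := κ) :=
  fun hκ ↦ ae_isSpaceFilling_sleTrace_of_ae_tendsto_norm_atTop hκ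
    (htr (lt_of_lt_of_le (by norm_num) hκ))

/-- The same from `exists_isSLECurve` (existence of chordal SLE_κ curves in every Dobrushin
domain), which is equivalent to the transience fact
(`tendsto_norm_sleTrace_atTop_iff_exists_isSLECurve`). [cite: RohdeSchramm2005, Cor. 7.4] -/
theorem ae_isSpaceFilling_sleTrace_of_eight_le_of_exists_isSLECurve (h : exists_isSLECurve) :
    ae_isSpaceFilling_sleTrace_of_eight_le (κ := κ) :=
  ae_isSpaceFilling_sleTrace_of_eight_le_of_tendsto_norm_sleTrace_atTop
    (tendsto_norm_sleTrace_atTop_of_exists_isSLECurve h)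

/-! ### The named fact from the finest isolated inputs for `κ ≥ 8` -/

/-- **`ae_isSpaceFilling_sleTrace_of_eight_le` from the leaf inputs for `κ ≥ 8`.** For `κ > 8`:
Rohde–Schramm's Cor. 3.5 on the canonical space (`h35`; it gives Thm. 5.1, hence the trace,
`hasSLETrace_of_ne_eight_of_cor35`) and the conclusion of Lemma 7.3 at `t = 1` for `κ > 8` (`h9`:
a.s. `K₁ ⊇ {z ∈ ℍ : |z| < ε}` for some `ε > 0`), which give transience
(`tendsto_norm_sleTrace_atTop_of_cor35_of_halfDisc_gt_eight`: positive probability of a sealed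
half-disc at a fixed time, scaling and the zero-one law). For `κ = 8`: SLE₈ generated by a curve
(`h8e`, [LSW] Thm. 4.7) and the Update of Thm. 7.1 (`h8`). Then
`ae_isSpaceFilling_sleTrace_of_ae_tendsto_norm_atTop`. [cite: RohdeSchramm2005, Cor. 7.4 and Update (p. 911)] -/
theorem ae_isSpaceFilling_sleTrace_of_eight_le_of_leaf_facts
    (h35 : RohdeSchramm2005_cor35 Process.preWienerMeasure)
    (h9 : ∀ {κ : ℝ≥0}, 8 < κ → ∀ᵐ ω ∂Process.preWienerMeasure,
      ∃ ε : ℝ, 0 < ε ∧ {z ∈ upperHalfPlaneSet | ‖z‖ < ε} ⊆ sleHull κ ω 1)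
    (h8e : hasSLETrace_eight) (h8 : RohdeSchramm2005_thm71_eight) :
    ae_isSpaceFilling_sleTrace_of_eight_le (κ := κ) := by
  intro hκ
  rcases hκ.eq_or_lt with h | hgt
  · subst h
    exact ae_isSpaceFilling_sleTrace_eight_of h8e (h8 h8e)
  · exact ae_isSpaceFilling_sleTrace_of_ae_tendsto_norm_atTop hκ
      (tendsto_norm_sleTrace_atTop_of_cor35_of_halfDisc_gt_eight h35 h9 hgt)

/-- The same with the `κ > 8` input quoted from the named fact `RohdeSchramm2005_lem73`
(Lemma 7.3, `4 < κ ≠ 8`, every `t > 0`), used only for `κ > 8` at `t = 1`.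
[cite: RohdeSchramm2005, Cor. 7.4 and Update (p. 911)] -/
theorem ae_isSpaceFilling_sleTrace_of_eight_le_of_cor35_of_RS05
    (h35 : RohdeSchramm2005_cor35 Process.preWienerMeasure) (h73 : RohdeSchramm2005_lem73)
    (h8e : hasSLETrace_eight) (h8 : RohdeSchramm2005_thm71_eight) :
    ae_isSpaceFilling_sleTrace_of_eight_le (κ := κ) :=
  ae_isSpaceFilling_sleTrace_of_eight_le_of_leaf_facts h35
    (fun h9 ↦ h73 (lt_trans (by norm_num) h9) (ne_of_gt h9) one_pos) h8e h8

/-- **Cor. 7.4 as printed (`κ > 8`) from Rohde–Schramm's inputs only**: Cor. 3.5 and the `κ > 8`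
branch of Lemma 7.3 at `t = 1`; Lawler–Schramm–Werner (2004) enters only at `κ = 8`.
[cite: RohdeSchramm2005, Cor. 7.4] -/
theorem ae_isSpaceFilling_sleTrace_of_eight_lt_of_cor35_of_halfDisc
    (h35 : RohdeSchramm2005_cor35 Process.preWienerMeasure)
    (h9 : ∀ {κ : ℝ≥0}, 8 < κ → ∀ᵐ ω ∂Process.preWienerMeasure,
      ∃ ε : ℝ, 0 < ε ∧ {z ∈ upperHalfPlaneSet | ‖z‖ < ε} ⊆ sleHull κ ω 1)
    (hκ : 8 < κ) :
    ∀ᵐ ω ∂Process.preWienerMeasure, IsSpaceFilling (sleTrace κ ω) :=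
  ae_isSpaceFilling_sleTrace_of_ae_tendsto_norm_atTop hκ.le
    (tendsto_norm_sleTrace_atTop_of_cor35_of_halfDisc_gt_eight h35 h9 hκ)

/-- **SLE₈ is a.s. space-filling from transience at `κ = 8` alone** (the Update to Cor. 7.4):
the hypothesis `hasSLETrace_eight` of `ae_isSpaceFilling_sleTrace_eight_of` is forced by the
transience hypothesis. [cite: RohdeSchramm2005, Cor. 7.4 and Update (p. 911)] -/
theorem ae_isSpaceFilling_sleTrace_eight_of_ae_tendsto_norm_atTop
    (htr : ∀ᵐ ω ∂Process.preWienerMeasure, Tendsto (fun t ↦ ‖sleTrace 8 ω t‖) atTop atTop) :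
    ∀ᵐ ω ∂Process.preWienerMeasure, IsSpaceFilling (sleTrace 8 ω) :=
  ae_isSpaceFilling_sleTrace_of_ae_tendsto_norm_atTop le_rfl htr

end Literature.Probability.RandomPlanarGeometry

end
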